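import Literature.MathematicalPhysics.QuantumLattice.DWaveSourceFreePressure
import Literature.MathematicalPhysics.QuantumLattice.BdGModeGainBound
import Literature.MathematicalPhysics.QuantumLattice.TorusFermiWeightSum
import HarnessLib

/-!
# The free `d`-wave-sourced Hubbard torus is inert: `p̃_L(β,μ,0,s) - p̃_L(β,μ,0,0) ≤ C₀(1 + log β)s²`

Topic `MathematicalPhysics/QuantumLattice`. For the `U = 0` Hubbard torus with the uniform `d_{x²-y²}`
pair source (`dWaveSourceTorus L 0 μ s`), the sourced pressure gain is quadratic in the source with
a Cooper-logarithmic coefficient, UNIFORMLY in all real sources `s`: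

  for every compact `[μ₁, μ₂] ⊂ (-4, 0)` there is `C₀` such that for `β ≥ 1`, `μ ∈ [μ₁, μ₂]`,
  `L ≥ max(3, ⌈β⌉)` and all `s ∈ ℝ`:
  `(log Tr e^{-βH_L(s)} - log Tr e^{-βH_L(0)})/(βL²) ≤ C₀ (1 + log β) s²`

(`dWaveSource_free_sourcedGain_le`) — the free `d`-wave pair susceptibility of the torus, including
its nonlinear regime, is `≲ 1 + log β` (Salmhofer, *Renormalization* (1999) §4.5.4: the Cooper bubble
`½N(0) log β + O(1)`; here as an UPPER bound, finite volume `L ≳ β`, `d`-wave form factor). Proof: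
the BdG partition function (`log_partitionFn_dWaveSourceTorus_zero_sub`), the per-mode gain bound
(`bdgModeGain_le`: `≤ βD_k²·β/(2+β|ξ_k|)`, `D_k² = 8s²ĝ_d(k)² ≤ 32s²`) and the torus Cooper logarithm
(`exists_sum_fermiWeight_le`, `μ` at distance `≥ min(μ₁+4, -μ₂)` from `{-4, 0, 4}`). The threshold
`L ≥ β` is genuine: at `μ` on a torus level the shell degeneracy gives a gain `∼ βs²/L²`.

This is hypothesis (F) of the reduction
`Summits/…/Theorems/ThermalWedgeTwSourcedInertnessReduction.twSourcedInertness_of_free_of_window` of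
crux `TwSourcedInertness` (route `ThermalWedge` of `HubbardSuperconductivity`), stated verbatim.
Everything is proved; no definition and no named fact.
-/

noncomputable section

namespace Literature.MathematicalPhysics.QuantumLattice

open Matrix Finset Literature.Probability.LatticeModels

/-- `|ĝ_d(k)| ≤ 2` for the `d_{x²-y²}` form factor `cos k₁ - cos k₂`. [folklore] -/
theorem abs_dWaveGap_le_two {L : ℕ} (k : TorusSite 2 L) : |dWaveGap k| ≤ 2 := by
  rw [dWaveGap]
  have h1 := Real.abs_cos_le_one (latticeMomentum L k 0)
  have h2 := Real.abs_cos_le_one (latticeMomentum L k 1)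
  calc |Real.cos (latticeMomentum L k 0) - Real.cos (latticeMomentum L k 1)|
      ≤ |Real.cos (latticeMomentum L k 0)| + |Real.cos (latticeMomentum L k 1)| := abs_sub _ _
    _ ≤ 2 := by linarith

/-- **The free `d`-wave-sourced torus is inert.** For every compact `[μ₁,μ₂] ⊂ (-4,0)` there is
`C₀ > 0` such that for all `β ≥ 1`, `μ ∈ [μ₁,μ₂]`, eventually in `L` (namely `L ≥ max(3,⌈β⌉)`) and for
ALL real sources `s`, `p̃_L(β,μ,0,s) - p̃_L(β,μ,0,0) ≤ C₀(1 + log β)s²`,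
`p̃_L = log Re Z_β(dWaveSourceTorus L 0 μ ·)/(βL²)`. [folklore] -/
theorem dWaveSource_free_sourcedGain_le :
    ∀ μ₁ μ₂ : ℝ, -4 < μ₁ → μ₁ ≤ μ₂ → μ₂ < 0 → ∃ C₀ : ℝ, 0 < C₀ ∧
      ∀ β : ℝ, 1 ≤ β → ∀ μ ∈ Set.Icc μ₁ μ₂, ∃ L₀ : ℕ, ∀ (L : ℕ) [NeZero L], L₀ ≤ L → ∀ s : ℝ,
        Real.log (partitionFn β (dWaveSourceTorus L 0 μ s)).re / (β * (L : ℝ) ^ 2) -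
            Real.log (partitionFn β (dWaveSourceTorus L 0 μ 0)).re / (β * (L : ℝ) ^ 2) ≤
          C₀ * (1 + Real.log β) * s ^ 2 := by
  intro μ₁ μ₂ h4 _h12 h0
  set d₀ := min (μ₁ + 4) (-μ₂) with hd₀def
  have hd₀ : 0 < d₀ := lt_min (by linarith) (by linarith)
  obtain ⟨C, hC, hsum⟩ := exists_sum_fermiWeight_le hd₀
  refine ⟨32 * (C + 8), by positivity, ?_⟩
  intro β hβ μ hμ
  have hβ0 : 0 < β := by linarith
  have hlogβ : 0 ≤ Real.log β := Real.log_nonneg hβ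
  have hμ4 : d₀ ≤ μ + 4 := (min_le_left _ _).trans (by linarith [hμ.1])
  have hμ0 : d₀ ≤ -μ := (min_le_right _ _).trans (by linarith [hμ.2])
  refine ⟨max 3 ⌈β⌉₊, fun L _ hL s => ?_⟩
  have hL3 : 3 ≤ L := le_of_max_le_left hL
  have hLβ : β ≤ L := (Nat.le_ceil β).trans (by exact_mod_cast le_of_max_le_right hL)
  have hLpos : (0 : ℝ) < L := by exact_mod_cast Nat.pos_of_ne_zero (NeZero.ne L)
  have hβL : 0 < β * (L : ℝ) ^ 2 := by positivity
  -- the gain as a sum over modes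
  rw [← sub_div, div_le_iff₀ hβL, log_partitionFn_dWaveSourceTorus_zero_sub hL3]
  -- per-mode bound
  have hmode : ∀ k : TorusSite 2 L,
      Real.log ((1 + Real.cosh (β * Real.sqrt ((torusBand L k - μ) ^ 2 + (2 * Real.sqrt 2 * s * dWaveGap k) ^ 2))) / 2) -
          Real.log ((1 + Real.cosh (β * (torusBand L k - μ))) / 2) ≤
        32 * β * s ^ 2 * (β / (2 + β * |torusBand L k - μ|)) := by
    intro k
    refine (bdgModeGain_le hβ0 (torusBand L k - μ) (2 * Real.sqrt 2 * s * dWaveGap k)).trans ?_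
    have hD : (2 * Real.sqrt 2 * s * dWaveGap k) ^ 2 ≤ 32 * s ^ 2 := by
      have hg := abs_dWaveGap_le_two k
      have hg2 : dWaveGap k ^ 2 ≤ 4 := by
        rw [← sq_abs]; nlinarith [abs_nonneg (dWaveGap k)]
      have hsqrt : Real.sqrt 2 ^ 2 = 2 := Real.sq_sqrt zero_le_two
      calc (2 * Real.sqrt 2 * s * dWaveGap k) ^ 2 = 8 * s ^ 2 * dWaveGap k ^ 2 := by
            rw [mul_pow, mul_pow, mul_pow, hsqrt]; ring
        _ ≤ 8 * s ^ 2 * 4 := by gcongr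
        _ = 32 * s ^ 2 := by ring
    have hw : 0 ≤ β / (2 + β * |torusBand L k - μ|) := by positivity
    calc β * (2 * Real.sqrt 2 * s * dWaveGap k) ^ 2 * (β / (2 + β * |torusBand L k - μ|))
        ≤ β * (32 * s ^ 2) * (β / (2 + β * |torusBand L k - μ|)) := by gcongr
      _ = 32 * β * s ^ 2 * (β / (2 + β * |torusBand L k - μ|)) := by ring
  have hS := hsum μ hμ4 hμ0 β hβ L
  calc ∑ k : TorusSite 2 L,
        (Real.log ((1 + Real.cosh (β * Real.sqrt ((torusBand L k - μ) ^ 2 + (2 * Real.sqrt 2 * s * dWaveGap k) ^ 2))) / 2) -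
          Real.log ((1 + Real.cosh (β * (torusBand L k - μ))) / 2))
      ≤ ∑ k : TorusSite 2 L, 32 * β * s ^ 2 * (β / (2 + β * |torusBand L k - μ|)) :=
        Finset.sum_le_sum fun k _ => hmode k
    _ = 32 * β * s ^ 2 * ∑ k : TorusSite 2 L, β / (2 + β * |torusBand L k - μ|) := by rw [Finset.mul_sum]
    _ ≤ 32 * β * s ^ 2 * (C * (1 + Real.log β) * (L : ℝ) ^ 2 + 8 * β * L) :=
        mul_le_mul_of_nonneg_left hS (by positivity)
    _ ≤ 32 * (C + 8) * (1 + Real.log β) * s ^ 2 * (β * (L : ℝ) ^ 2) := by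
        -- `8βL ≤ 8 L² ≤ 8(1 + log β)L²` since `β ≤ L`
        have h1 : β * (L : ℝ) ≤ (L : ℝ) ^ 2 := by rw [sq]; exact mul_le_mul_of_nonneg_right hLβ hLpos.le
        have h2 : (0 : ℝ) ≤ 32 * β * s ^ 2 := by positivity
        have h3 : 8 * β * (L : ℝ) ≤ 8 * (1 + Real.log β) * (L : ℝ) ^ 2 := by nlinarith
        nlinarith [mul_le_mul_of_nonneg_left h3 h2, sq_nonneg s, sq_nonneg (L : ℝ)]

end Literature.MathematicalPhysics.QuantumLattice
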